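import Summits.Ventures.WeilGRH.UniformConductorFloorLog8HalfTableValidA
import Summits.Ventures.WeilGRH.UniformConductorFloorLog8HalfTableValidB
import Summits.Ventures.WeilGRH.UniformConductorFloorLog8HalfTableValidC
import Summits.Ventures.WeilGRH.UniformConductorFloorLog8HalfTableValidD
import Summits.Ventures.WeilGRH.UniformConductorFloorLog8HalfTableValidE
import Summits.Ventures.WeilGRH.UniformConductorFloorLog8HalfTableValidF
import Summits.Ventures.WeilGRH.UniformConductorFloorLog8HalfTableValidG
import HarnessLib

/-!
# GRH arm (rh-explicit, venture WeilGRH): the special-value table `Log8HalfTable` — `tab_valid : TabValid (2^80) a ks 160 tab` (glue of the kernel parts)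

Cell `rh-explicit`, WEIL TRACK — GRH ARM (weil-grh-1 gen10; glue of gen9's kernel parts A–G, re-cut so that the parts after A import only A and file
in parallel).  Part A certifies `P`, `A`, `C`, the prime data and the first modes; the later parts certify `checkTable` slices; this file chains them with
`TabValid.extend` into `tab_valid : TabValid (2^80) a ks 160 tab` — the input of weil-grh-2's twisted cell kits (doors E/C) and of the table-based Galerkin
refutation `UniformConductorFloorGalerkinTab` at this window.  No kernel computation here; no definitions; standard axioms.
[cite: Moore1966, Ch. 3 (interval arithmetic: inclusion property)]
-/

namespace Summit.Ventures.WeilGRH.Log8HalfTable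
open Literature.NumberTheory.LFunctions Literature.NumberTheory.LFunctions.Yoshida1992 Encl Literature.Analysis.ValidatedNumerics.NumericsMP

/-- The table is valid below `50`. [cite: Moore1966, Ch. 3 (interval arithmetic: inclusion property)] -/
theorem tab_valid50 : TabValid (2 ^ 80) a ks (25 + 25) tab :=
  tab_valid25.extend fun n hn hnk ↦ idxValid_of_checkTable (prm := prm) (by norm_num [prm]) a_pos consts_valid tT25 hn hnk

/-- The table is valid below `75`. [cite: Moore1966, Ch. 3 (interval arithmetic: inclusion property)] -/
theorem tab_valid75 : TabValid (2 ^ 80) a ks (50 + 25) tab :=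
  tab_valid50.extend fun n hn hnk ↦ idxValid_of_checkTable (prm := prm) (by norm_num [prm]) a_pos consts_valid tT50 hn hnk

/-- The table is valid below `100`. [cite: Moore1966, Ch. 3 (interval arithmetic: inclusion property)] -/
theorem tab_valid100 : TabValid (2 ^ 80) a ks (75 + 25) tab :=
  tab_valid75.extend fun n hn hnk ↦ idxValid_of_checkTable (prm := prm) (by norm_num [prm]) a_pos consts_valid tT75 hn hnk

/-- The table is valid below `125`. [cite: Moore1966, Ch. 3 (interval arithmetic: inclusion property)] -/
theorem tab_valid125 : TabValid (2 ^ 80) a ks (100 + 25) tab :=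
  tab_valid100.extend fun n hn hnk ↦ idxValid_of_checkTable (prm := prm) (by norm_num [prm]) a_pos consts_valid tT100 hn hnk

/-- The table is valid below `150`. [cite: Moore1966, Ch. 3 (interval arithmetic: inclusion property)] -/
theorem tab_valid150 : TabValid (2 ^ 80) a ks (125 + 25) tab :=
  tab_valid125.extend fun n hn hnk ↦ idxValid_of_checkTable (prm := prm) (by norm_num [prm]) a_pos consts_valid tT125 hn hnk

/-- The table is valid below `160`. [cite: Moore1966, Ch. 3 (interval arithmetic: inclusion property)] -/
theorem tab_valid160 : TabValid (2 ^ 80) a ks (150 + 10) tab :=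
  tab_valid150.extend fun n hn hnk ↦ idxValid_of_checkTable (prm := prm) (by norm_num [prm]) a_pos consts_valid tT150 hn hnk

/-- ★ The special-value table `Log8HalfTable.tab` is valid below `160`. [cite: Moore1966, Ch. 3 (interval arithmetic: inclusion property)] -/
theorem tab_valid : TabValid (2 ^ 80) a ks 160 tab := tab_valid160

end Summit.Ventures.WeilGRH.Log8HalfTable
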